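import Mathlib
import Summits.NavierStokesRegularity.NavierStokesRegularity.Theorems.FilamentSkeletonRssDefectColumnGateAzimuthalBlockTwoZoneConstantsPrelim

/-!
# Route `FilamentSkeletonRss` · crux `TransverseReduction1AG` (stmt-NavierStokesRegularity-27853; A1L twin stmt-23297) · line
# `defect_column_gate_1AG/1AL` — SIZE of the two-zone constants: `(1+u₀+2/γ)⁴T̄ + 16Q̄ ≤ K_c·(1+u₀)¹¹·Rc³·M_E²`

Helper file (`--supports stmt-NavierStokesRegularity-27853 --as helper`; seat ns-filament-s2aloc-p1 g2; note ARCHITECTURE-B2B3-s2aloc-g2.md v6 §8).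
The output of `twoZone_sup_le` (p680567) is `(1 + u₀ + 2/γ)⁴·T̄ + 16·Q̄` with `T̄, Q̄` explicit in the abbreviations.  `twoZone_constants_le`: with
`e^{γu₀/4} = Rc³` (the choice `u₀ = (12/γ)log Rc` of `twoZone_loop_large_three`) and `θ′ = (u₀−1/γ)/(e(A₂b+1)c_Φ)` this quantity is
`≤ K_c·(1+u₀)¹¹·Rc³·M_E²`, `K_c = K_c(γ, m)` an explicit polynomial in `γ, 1/γ, 1/m` (abbreviations `a₂, c_φ, a₁, a₃, b₀, f₀, s_S, t_T, K_c` in the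
statement), `M_E = M + γ²Rc(1+u₀)²e^{−γu₀/4}N/(8πm)` the folded data size: POLYNOMIAL LOSS `Rc³·(1 + (12/γ)log Rc)¹¹` for the Biot–Savart-coupled
azimuthal blocks `m ≥ 2` of the symmetric column, uniformly in the support radius.  (The remaining `N² ≤ sup(1+u)⁴(a²+b²)` absorption has coefficient
`2K_c(1+u₀)¹¹Rc³·(γ²(1+u₀)²/(8πmRc²))² = O((1+u₀)¹⁵/Rc)`; not done here.)
HONEST FRAMING: elementary real inequalities serving an a-priori bound for ONE family of blocks of ONE linear MODEL operator of a hypothetical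
blow-up route (MODEL rung, negative side); `WaistColumnGateLoc1A`, `TransverseReduction1AG/1AL` are neither proved nor refuted; nothing here
bears on NS regularity.
-/

set_option linter.dupNamespace false

noncomputable section

namespace Summit.NavierStokesRegularity.NavierStokesRegularity.Theorems.DefectColumnGate

open Set

set_option maxHeartbeats 2000000 in
/-- **Size of the two-zone constants.**  Under the abbreviations of `twoZone_sup_le`, `e^{γu₀/4} = Rc³`, the `θ′` choice, `0 ≤ M`, `0 ≤ N`:
`(1 + (u₀ + 2/γ))⁴·T̄ + 16·Q̄ ≤ K_c·(1+u₀)¹¹·Rc³·M_E²`. -/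
theorem twoZone_constants_le
    {γ m Rc u₀ θ' M N Kb ME c₁ κ A₁b A₂b A₃b cΦ φ₀ φ₁ ξ₀ ξ₁ β₀ β₁ β₂ τ₀ τ₁ τ₂ e₁ α₁ α₂ S₀ Qb Tb a₂ cφ a₁ a₃ b₀ f₀ sS tT Kc : ℝ}
    (hγ : 0 < γ) (hm : 2 ≤ m) (hRc : 1 ≤ Rc) (hu₀ : 64 / γ ≤ u₀) (hu₀1 : 1 ≤ u₀) (hM : 0 ≤ M) (hN : 0 ≤ N)
    (hE : Real.exp (γ * u₀ / 4) = Rc ^ 3)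
    (hKb : Kb = 2 * Real.pi * (u₀ + 2 / γ + 4 / γ))
    (hME : ME = M + γ ^ 2 * Rc / (8 * Real.pi * m) * ((1 + u₀) ^ 2 * Real.exp (-(γ * u₀ / 4))) * N)
    (hc₁ : c₁ = (1 - 16 / (5 * m ^ 2)) * m) (hκ : κ = γ ^ 2 * Rc / (16 * Real.pi * m))
    (hA₁b : A₁b = (u₀ + 2 / γ) * Real.exp (γ * (u₀ + 2 / γ) / 4) / Rc * (4 * Kb * ((γ + 1) * Kb + 4) / c₁ ^ 2 + 1 / 2))
    (hA₂b : A₂b = 4 * ((γ + 1) * Kb + 4) / c₁) (hA₃b : A₃b = κ * (1 + A₂b))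
    (hcΦ : cΦ = 12 * ((1 + 36 * γ ^ 2) * (u₀ + 3 / γ) + 81 * γ / 32 + 81 / 64))
    (hφ₁ : φ₁ = Real.exp (γ * (u₀ + 3 / γ) / 4) * cΦ)
    (hφ₀ : φ₀ = Real.exp (γ * (u₀ + 3 / γ) / 4) * (cΦ * (16 * ME ^ 2 / (γ ^ 2 * u₀ ^ 4)) + 243 / 8 * (ME ^ 2 / (1 + u₀) ^ 4)))
    (hξ₁ : ξ₁ = u₀ ^ 2 / 2) (hξ₀ : ξ₀ = 8 * ME ^ 2 / (γ ^ 2 * u₀ ^ 2))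
    (hβ₀ : β₀ = Kb * (4 * Kb * (M ^ 2 * ((u₀ + 2 / γ) * Real.exp (γ * (u₀ + 2 / γ) / 4))) / (c₁ ^ 2 * Rc ^ 2)))
    (hβ₁ : β₁ = Kb * (4 / (c₁ * Rc))) (hβ₂ : β₂ = Kb * (4 * κ / (c₁ * Rc)))
    (hτ₀ : τ₀ = A₁b * M ^ 2) (hτ₁ : τ₁ = A₂b + 1) (hτ₂ : τ₂ = A₃b)
    (he₁ : e₁ = Real.exp (1 / 4) / Real.exp (γ * u₀ / 4)) (hα₁ : α₁ = γ + 1 / θ') (hα₂ : α₂ = θ' / (4 * (u₀ - 1 / γ)))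
    (hθ' : θ' = (u₀ - 1 / γ) / (Real.exp 1 * (A₂b + 1) * cΦ))
    (hS₀ : S₀ = 2 * (e₁ * (α₁ * (β₀ + β₁ * φ₀ + β₂ * ξ₀) + α₂ * (τ₀ + τ₁ * φ₀ + τ₂ * ξ₀))))
    (hQb : Qb = 16 * ME ^ 2 / γ ^ 2 + u₀ ^ 4 * S₀)
    (hTb : Tb = τ₀ + τ₁ * (φ₀ + φ₁ * S₀) + τ₂ * (ξ₀ + ξ₁ * S₀))
    (ha₂ : a₂ = 20 / m * (4 * Real.pi * (γ + 1) + 4) + 1)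
    (hcφ : cφ = 12 * (2 * (1 + 36 * γ ^ 2) + 81 * γ / 32 + 81 / 64))
    (ha₁ : a₁ = γ + 12 * a₂ * cφ)
    (ha₃ : a₃ = 6 * (400 * Real.pi * (4 * Real.pi * (γ + 1) + 4) / m ^ 2 + 1 / 2))
    (hb₀ : b₀ = 9600 * Real.pi ^ 2 / m ^ 2)
    (hf₀ : f₀ = 3 * (16 * cφ / γ ^ 2 + 243 / 8))
    (hsS : sS = 6 * a₁ * b₀ + 6 * a₃ + 2 * (240 * Real.pi * a₁ * f₀ / m + 120 * a₁ / m ^ 2 + 3 * f₀ + a₂ / m))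
    (htT : tT = a₃ + a₂ * f₀ + 3 * a₂ * cφ * sS + a₂ / m + γ ^ 2 * a₂ * sS / m)
    (hKc : Kc = 16 * tT + 16 * (16 / γ ^ 2 + sS)) :
    (1 + (u₀ + 2 / γ)) ^ 4 * Tb + 16 * Qb ≤ Kc * (1 + u₀) ^ 11 * Rc ^ 3 * ME ^ 2 := by
  -- ### basic sizes and the piece bounds
  have hπ : 0 < Real.pi := Real.pi_pos
  have hπ3 : 3 < Real.pi := Real.pi_gt_three
  have hm0 : 0 < m := by linarith
  have hRc0 : 0 < Rc := by linarith
  have hu₀0 : 0 < u₀ := by linarith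
  obtain ⟨hMME, hME0, hu2, ⟨hτ₀le, hτ₀0⟩, ⟨hτ₁le, hτ₁0⟩, ⟨hτ₂le, hτ₂0⟩, ⟨hφ₁le, hφ₁0⟩, ⟨hφ₀le, hφ₀0⟩, ⟨hξ₁le, hξ₁0⟩, ⟨hξ₀le, hξ₀0⟩,
    ⟨hβ₀le, hβ₀0⟩, ⟨hβ₁le, hβ₁0⟩, ⟨hβ₂le, hβ₂0⟩, ⟨he₁le, he₁0⟩, ⟨hα₁le, hα₁0⟩, ⟨hα₂le, hα₂0⟩, hα₂τ₁⟩ :=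
    twoZone_pieces_le hγ hm hRc hu₀ hu₀1 hM hN hE hKb hME hc₁ hκ hA₁b hA₂b hA₃b hcΦ hφ₁ hφ₀ hξ₁ hξ₀ hβ₀ hβ₁ hβ₂ hτ₀ hτ₁ hτ₂ he₁ hα₁ hα₂
      hθ' ha₂ hcφ ha₁ ha₃ hb₀ hf₀
  set P : ℝ := 1 + u₀ with hPdef
  have hP1 : 1 ≤ P := by rw [hPdef]; linarith
  have hP0 : 0 < P := by linarith
  have huP : u₀ ≤ P := by rw [hPdef]; linarith
  have hPpow : ∀ {j k : ℕ}, j ≤ k → P ^ j ≤ P ^ k := fun hjk => pow_le_pow_right₀ hP1 hjk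
  have hRpow : ∀ {j k : ℕ}, j ≤ k → Rc ^ j ≤ Rc ^ k := fun hjk => pow_le_pow_right₀ hRc hjk
  have ha₂0 : 0 < a₂ := by rw [ha₂]; positivity
  have hcφ0 : 0 < cφ := by rw [hcφ]; positivity
  have ha₁0 : 0 < a₁ := by rw [ha₁]; positivity
  have ha₃0 : 0 < a₃ := by rw [ha₃]; positivity
  have hb₀0 : 0 < b₀ := by rw [hb₀]; positivity
  have hf₀0 : 0 < f₀ := by rw [hf₀]; positivity
  have hME2 : 0 ≤ ME ^ 2 := by positivity

  -- ### the six terms of `S₀`, each `≤ c · P⁴ · {M², M_E²}`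
  have hR13 : Rc ≤ Rc ^ 3 := by have := hRpow (show 1 ≤ 3 by norm_num); rw [pow_one] at this; exact this
  have hR23 : Rc ^ 2 ≤ Rc ^ 3 := hRpow (by norm_num)
  have hR03 : 1 ≤ Rc ^ 3 := one_le_pow₀ hRc
  have ht1 : e₁ * α₁ * β₀ ≤ 3 * a₁ * b₀ * P ^ 4 * M ^ 2 := by
    have h1 : e₁ * α₁ * β₀ ≤ (3 / Rc ^ 3) * (a₁ * P) * (b₀ * P ^ 3 * Rc * M ^ 2) :=
      mul_le_mul_three he₁le hα₁le hβ₀le he₁0 hα₁0 hβ₀0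
    have h2 : (3 / Rc ^ 3) * (a₁ * P) * (b₀ * P ^ 3 * Rc * M ^ 2) = 3 * a₁ * b₀ * P ^ 4 * M ^ 2 * (Rc / Rc ^ 3) := by
      field_simp
    have h3 : Rc / Rc ^ 3 ≤ 1 := by rw [div_le_one (by positivity)]; exact hR13
    have h4 : 3 * a₁ * b₀ * P ^ 4 * M ^ 2 * (Rc / Rc ^ 3) ≤ 3 * a₁ * b₀ * P ^ 4 * M ^ 2 * 1 :=
      mul_le_mul_of_nonneg_left h3 (by positivity)
    linarith only [h1, h2, h4]
  have ht2 : e₁ * α₁ * β₁ * φ₀ ≤ 240 * Real.pi * a₁ * f₀ / m * P ^ 4 * ME ^ 2 := by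
    have h1 : e₁ * α₁ * β₁ * φ₀ ≤ (3 / Rc ^ 3) * (a₁ * P) * (80 * Real.pi * P / (m * Rc)) * (f₀ * P * Rc ^ 3 * ME ^ 2) :=
      mul_le_mul_four he₁le hα₁le hβ₁le hφ₀le he₁0 hα₁0 hβ₁0 hφ₀0
    have h2 : (3 / Rc ^ 3) * (a₁ * P) * (80 * Real.pi * P / (m * Rc)) * (f₀ * P * Rc ^ 3 * ME ^ 2)
        = 240 * Real.pi * a₁ * f₀ / m * P ^ 3 * ME ^ 2 * (1 / Rc) := by
      field_simp
      ring
    have h3 : 1 / Rc ≤ 1 := by rw [div_le_one hRc0]; exact hRc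
    have h4 : 240 * Real.pi * a₁ * f₀ / m * P ^ 3 * ME ^ 2 * (1 / Rc) ≤ 240 * Real.pi * a₁ * f₀ / m * P ^ 4 * ME ^ 2 * 1 :=
      mul_le_mul (mul_le_mul_of_nonneg_right (mul_le_mul_of_nonneg_left (hPpow (by norm_num)) (by positivity)) hME2) h3
        (by positivity) (by positivity)
    linarith only [h1, h2, h4]
  have ht3 : e₁ * α₁ * β₂ * ξ₀ ≤ 120 * a₁ / m ^ 2 * P ^ 4 * ME ^ 2 := by
    have h1 : e₁ * α₁ * β₂ * ξ₀ ≤ (3 / Rc ^ 3) * (a₁ * P) * (5 * γ ^ 2 * P / m ^ 2) * (8 * ME ^ 2 / γ ^ 2) :=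
      mul_le_mul_four he₁le hα₁le hβ₂le hξ₀le he₁0 hα₁0 hβ₂0 hξ₀0
    have h2 : (3 / Rc ^ 3) * (a₁ * P) * (5 * γ ^ 2 * P / m ^ 2) * (8 * ME ^ 2 / γ ^ 2)
        = 120 * a₁ / m ^ 2 * P ^ 2 * ME ^ 2 * (1 / Rc ^ 3) := by
      field_simp
      ring
    have h3 : 1 / Rc ^ 3 ≤ 1 := by rw [div_le_one (by positivity)]; exact hR03
    have h4 : 120 * a₁ / m ^ 2 * P ^ 2 * ME ^ 2 * (1 / Rc ^ 3) ≤ 120 * a₁ / m ^ 2 * P ^ 4 * ME ^ 2 * 1 :=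
      mul_le_mul (mul_le_mul_of_nonneg_right (mul_le_mul_of_nonneg_left (hPpow (by norm_num)) (by positivity)) hME2) h3
        (by positivity) (by positivity)
    linarith only [h1, h2, h4]
  have ht4 : e₁ * α₂ * τ₀ ≤ 3 * a₃ * P ^ 4 * M ^ 2 := by
    have h1 : e₁ * α₂ * τ₀ ≤ (3 / Rc ^ 3) * 1 * (a₃ * P ^ 3 * Rc ^ 2 * M ^ 2) :=
      mul_le_mul_three he₁le hα₂le hτ₀le he₁0 hα₂0 hτ₀0
    have h2 : (3 / Rc ^ 3) * 1 * (a₃ * P ^ 3 * Rc ^ 2 * M ^ 2) = 3 * a₃ * P ^ 3 * M ^ 2 * (Rc ^ 2 / Rc ^ 3) := by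
      field_simp
    have h3 : Rc ^ 2 / Rc ^ 3 ≤ 1 := by rw [div_le_one (by positivity)]; exact hR23
    have h4 : 3 * a₃ * P ^ 3 * M ^ 2 * (Rc ^ 2 / Rc ^ 3) ≤ 3 * a₃ * P ^ 4 * M ^ 2 * 1 :=
      mul_le_mul (mul_le_mul_of_nonneg_right (mul_le_mul_of_nonneg_left (hPpow (by norm_num)) (by positivity)) (sq_nonneg M)) h3
        (by positivity) (by positivity)
    linarith only [h1, h2, h4]
  have ht5 : e₁ * (α₂ * τ₁) * φ₀ ≤ 3 * f₀ * P ^ 4 * ME ^ 2 := by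
    have h1 : e₁ * (α₂ * τ₁) * φ₀ ≤ (3 / Rc ^ 3) * 1 * (f₀ * P * Rc ^ 3 * ME ^ 2) :=
      mul_le_mul_three he₁le hα₂τ₁ hφ₀le he₁0 (by positivity) hφ₀0
    have h2 : (3 / Rc ^ 3) * 1 * (f₀ * P * Rc ^ 3 * ME ^ 2) = 3 * f₀ * P * ME ^ 2 := by field_simp
    have h4 : 3 * f₀ * P * ME ^ 2 ≤ 3 * f₀ * P ^ 4 * ME ^ 2 := by
      have := hPpow (show 1 ≤ 4 by norm_num); rw [pow_one] at this
      exact mul_le_mul_of_nonneg_right (mul_le_mul_of_nonneg_left this (by positivity)) hME2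
    linarith only [h1, h2, h4]
  have ht6 : e₁ * α₂ * τ₂ * ξ₀ ≤ a₂ / m * P ^ 4 * ME ^ 2 := by
    have h1 : e₁ * α₂ * τ₂ * ξ₀ ≤ (3 / Rc ^ 3) * 1 * (γ ^ 2 * Rc / (16 * Real.pi * m) * (a₂ * P)) * (8 * ME ^ 2 / γ ^ 2) :=
      mul_le_mul_four he₁le hα₂le hτ₂le hξ₀le he₁0 hα₂0 hτ₂0 hξ₀0
    have h2 : (3 / Rc ^ 3) * 1 * (γ ^ 2 * Rc / (16 * Real.pi * m) * (a₂ * P)) * (8 * ME ^ 2 / γ ^ 2)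
        = a₂ / m * P * ME ^ 2 * (3 / (2 * Real.pi) * (Rc / Rc ^ 3)) := by
      field_simp; ring
    have h3 : 3 / (2 * Real.pi) * (Rc / Rc ^ 3) ≤ 1 := by
      have h5 : 3 / (2 * Real.pi) ≤ 1 := by rw [div_le_one (by positivity)]; linarith
      have h6 : Rc / Rc ^ 3 ≤ 1 := by rw [div_le_one (by positivity)]; exact hR13
      exact mul_le_one₀ h5 (by positivity) h6
    have h4 : a₂ / m * P * ME ^ 2 * (3 / (2 * Real.pi) * (Rc / Rc ^ 3)) ≤ a₂ / m * P ^ 4 * ME ^ 2 * 1 := by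
      have := hPpow (show 1 ≤ 4 by norm_num); rw [pow_one] at this
      exact mul_le_mul (mul_le_mul_of_nonneg_right (mul_le_mul_of_nonneg_left this (by positivity)) hME2) h3
        (by positivity) (by positivity)
    linarith only [h1, h2, h4]
  -- `S₀ ≤ sS P⁴ ME²`
  have hsS0 : 0 < sS := by rw [hsS]; positivity
  have hS₀le : S₀ ≤ sS * P ^ 4 * ME ^ 2 := by
    rw [hS₀, hsS]
    have e : 2 * (e₁ * (α₁ * (β₀ + β₁ * φ₀ + β₂ * ξ₀) + α₂ * (τ₀ + τ₁ * φ₀ + τ₂ * ξ₀)))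
        = 2 * (e₁ * α₁ * β₀ + e₁ * α₁ * β₁ * φ₀ + e₁ * α₁ * β₂ * ξ₀ + e₁ * α₂ * τ₀ + e₁ * (α₂ * τ₁) * φ₀ + e₁ * α₂ * τ₂ * ξ₀) := by
      ring
    rw [e]
    have hM4 : P ^ 4 * M ^ 2 ≤ P ^ 4 * ME ^ 2 := mul_le_mul_of_nonneg_left hMME (by positivity)
    have hM4a : 3 * a₁ * b₀ * (P ^ 4 * M ^ 2) ≤ 3 * a₁ * b₀ * (P ^ 4 * ME ^ 2) := mul_le_mul_of_nonneg_left hM4 (by positivity)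
    have hM4b : 3 * a₃ * (P ^ 4 * M ^ 2) ≤ 3 * a₃ * (P ^ 4 * ME ^ 2) := mul_le_mul_of_nonneg_left hM4 (by positivity)
    linarith only [ht1, ht2, ht3, ht4, ht5, ht6, hM4a, hM4b]
  have hS₀0 : 0 ≤ S₀ := by
    rw [hS₀]
    have : 0 ≤ e₁ * (α₁ * (β₀ + β₁ * φ₀ + β₂ * ξ₀) + α₂ * (τ₀ + τ₁ * φ₀ + τ₂ * ξ₀)) := by positivity
    linarith
  -- `Q̄ ≤ (16/γ² + sS) P⁸ ME²`
  have hQle : Qb ≤ (16 / γ ^ 2 + sS) * P ^ 8 * ME ^ 2 := by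
    rw [hQb]
    have h1 : u₀ ^ 4 * S₀ ≤ P ^ 4 * (sS * P ^ 4 * ME ^ 2) :=
      mul_le_mul (pow_le_pow_left₀ hu₀0.le huP 4) hS₀le hS₀0 (by positivity)
    have h2 : 16 * ME ^ 2 / γ ^ 2 ≤ 16 / γ ^ 2 * P ^ 8 * ME ^ 2 := by
      have h8 : 1 ≤ P ^ 8 := one_le_pow₀ hP1
      have e : 16 * ME ^ 2 / γ ^ 2 = 16 / γ ^ 2 * 1 * ME ^ 2 := by ring
      rw [e]
      exact mul_le_mul_of_nonneg_right (mul_le_mul_of_nonneg_left h8 (by positivity)) hME2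
    have e2 : (16 / γ ^ 2 + sS) * P ^ 8 * ME ^ 2 = 16 / γ ^ 2 * P ^ 8 * ME ^ 2 + P ^ 4 * (sS * P ^ 4 * ME ^ 2) := by ring
    rw [e2]; linarith only [h1, h2]
  -- `T̄ ≤ tT P⁷ Rc³ ME²`
  have htT0 : 0 < tT := by rw [htT]; positivity
  have hW : ∀ {j k : ℕ}, j ≤ 7 → k ≤ 3 → P ^ j * Rc ^ k ≤ P ^ 7 * Rc ^ 3 := fun hj hk =>
    mul_le_mul (hPpow hj) (hRpow hk) (by positivity) (by positivity)
  have hT1 : τ₀ ≤ a₃ * (P ^ 7 * Rc ^ 3) * ME ^ 2 := by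
    have h1 : a₃ * P ^ 3 * Rc ^ 2 * M ^ 2 ≤ a₃ * (P ^ 7 * Rc ^ 3) * ME ^ 2 := by
      have := hW (show 3 ≤ 7 by norm_num) (show 2 ≤ 3 by norm_num)
      have e : a₃ * P ^ 3 * Rc ^ 2 * M ^ 2 = a₃ * (P ^ 3 * Rc ^ 2) * M ^ 2 := by ring
      rw [e]; exact mul_le_mul (mul_le_mul_of_nonneg_left this ha₃0.le) hMME (sq_nonneg M) (by positivity)
    exact hτ₀le.trans h1
  have hT2 : τ₁ * φ₀ ≤ a₂ * f₀ * (P ^ 7 * Rc ^ 3) * ME ^ 2 := by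
    have h1 : τ₁ * φ₀ ≤ (a₂ * P) * (f₀ * P * Rc ^ 3 * ME ^ 2) := mul_le_mul hτ₁le hφ₀le hφ₀0 (by positivity)
    have h2 : (a₂ * P) * (f₀ * P * Rc ^ 3 * ME ^ 2) = a₂ * f₀ * (P ^ 2 * Rc ^ 3) * ME ^ 2 := by ring
    have h3 : a₂ * f₀ * (P ^ 2 * Rc ^ 3) * ME ^ 2 ≤ a₂ * f₀ * (P ^ 7 * Rc ^ 3) * ME ^ 2 :=
      mul_le_mul_of_nonneg_right (mul_le_mul_of_nonneg_left (hW (by norm_num) le_rfl) (by positivity)) hME2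
    linarith only [h1, h2, h3]
  have hT3 : τ₁ * (φ₁ * S₀) ≤ 3 * a₂ * cφ * sS * (P ^ 7 * Rc ^ 3) * ME ^ 2 := by
    have h1 : τ₁ * (φ₁ * S₀) ≤ (a₂ * P) * ((3 * Rc ^ 3 * (cφ * P)) * (sS * P ^ 4 * ME ^ 2)) :=
      mul_le_mul hτ₁le (mul_le_mul hφ₁le hS₀le hS₀0 (by positivity)) (by positivity) (by positivity)
    have h2 : (a₂ * P) * ((3 * Rc ^ 3 * (cφ * P)) * (sS * P ^ 4 * ME ^ 2)) = 3 * a₂ * cφ * sS * (P ^ 6 * Rc ^ 3) * ME ^ 2 := by ring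
    have h3 : 3 * a₂ * cφ * sS * (P ^ 6 * Rc ^ 3) * ME ^ 2 ≤ 3 * a₂ * cφ * sS * (P ^ 7 * Rc ^ 3) * ME ^ 2 :=
      mul_le_mul_of_nonneg_right (mul_le_mul_of_nonneg_left (hW (by norm_num) le_rfl) (by positivity)) hME2
    linarith only [h1, h2, h3]
  have hT4 : τ₂ * ξ₀ ≤ a₂ / m * (P ^ 7 * Rc ^ 3) * ME ^ 2 := by
    have h1 : τ₂ * ξ₀ ≤ (γ ^ 2 * Rc / (16 * Real.pi * m) * (a₂ * P)) * (8 * ME ^ 2 / γ ^ 2) := mul_le_mul hτ₂le hξ₀le hξ₀0 (by positivity)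
    have h2 : (γ ^ 2 * Rc / (16 * Real.pi * m) * (a₂ * P)) * (8 * ME ^ 2 / γ ^ 2) = a₂ / m * (P * Rc) * ME ^ 2 * (1 / (2 * Real.pi)) := by
      field_simp; ring
    have h3 : 1 / (2 * Real.pi) ≤ 1 := by rw [div_le_one (by positivity)]; linarith
    have h4 : a₂ / m * (P * Rc) * ME ^ 2 * (1 / (2 * Real.pi)) ≤ a₂ / m * (P ^ 7 * Rc ^ 3) * ME ^ 2 * 1 := by
      have := hW (show 1 ≤ 7 by norm_num) (show 1 ≤ 3 by norm_num); rw [pow_one, pow_one] at this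
      exact mul_le_mul (mul_le_mul_of_nonneg_right (mul_le_mul_of_nonneg_left this (by positivity)) hME2) h3 (by positivity)
        (by positivity)
    linarith only [h1, h2, h4]
  have hT5 : τ₂ * (ξ₁ * S₀) ≤ γ ^ 2 * a₂ * sS / m * (P ^ 7 * Rc ^ 3) * ME ^ 2 := by
    have h1 : τ₂ * (ξ₁ * S₀) ≤ (γ ^ 2 * Rc / (16 * Real.pi * m) * (a₂ * P)) * ((P ^ 2 / 2) * (sS * P ^ 4 * ME ^ 2)) :=
      mul_le_mul hτ₂le (mul_le_mul hξ₁le hS₀le hS₀0 (by positivity)) (by positivity) (by positivity)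
    have h2 : (γ ^ 2 * Rc / (16 * Real.pi * m) * (a₂ * P)) * ((P ^ 2 / 2) * (sS * P ^ 4 * ME ^ 2))
        = γ ^ 2 * a₂ * sS / m * (P ^ 7 * Rc) * ME ^ 2 * (1 / (32 * Real.pi)) := by
      field_simp; ring
    have h3 : 1 / (32 * Real.pi) ≤ 1 := by rw [div_le_one (by positivity)]; linarith
    have h4 : γ ^ 2 * a₂ * sS / m * (P ^ 7 * Rc) * ME ^ 2 * (1 / (32 * Real.pi)) ≤ γ ^ 2 * a₂ * sS / m * (P ^ 7 * Rc ^ 3) * ME ^ 2 * 1 := by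
      have := hW (show 7 ≤ 7 by norm_num) (show 1 ≤ 3 by norm_num); rw [pow_one] at this
      exact mul_le_mul (mul_le_mul_of_nonneg_right (mul_le_mul_of_nonneg_left this (by positivity)) hME2) h3 (by positivity)
        (by positivity)
    linarith only [h1, h2, h4]
  have hTle : Tb ≤ tT * (P ^ 7 * Rc ^ 3) * ME ^ 2 := by
    rw [hTb, htT]
    have e : τ₀ + τ₁ * (φ₀ + φ₁ * S₀) + τ₂ * (ξ₀ + ξ₁ * S₀) = τ₀ + τ₁ * φ₀ + τ₁ * (φ₁ * S₀) + τ₂ * ξ₀ + τ₂ * (ξ₁ * S₀) := by ring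
    rw [e]
    have e2 : (a₃ + a₂ * f₀ + 3 * a₂ * cφ * sS + a₂ / m + γ ^ 2 * a₂ * sS / m) * (P ^ 7 * Rc ^ 3) * ME ^ 2
        = a₃ * (P ^ 7 * Rc ^ 3) * ME ^ 2 + a₂ * f₀ * (P ^ 7 * Rc ^ 3) * ME ^ 2 + 3 * a₂ * cφ * sS * (P ^ 7 * Rc ^ 3) * ME ^ 2
          + a₂ / m * (P ^ 7 * Rc ^ 3) * ME ^ 2 + γ ^ 2 * a₂ * sS / m * (P ^ 7 * Rc ^ 3) * ME ^ 2 := by ring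
    rw [e2]; linarith only [hT1, hT2, hT3, hT4, hT5]
  have hT0 : 0 ≤ Tb := by rw [hTb]; positivity
  -- ### conclusion
  have h14 : (1 + (u₀ + 2 / γ)) ^ 4 ≤ 16 * P ^ 4 := by
    have h1 : 1 + (u₀ + 2 / γ) ≤ 2 * P := hu2
    have h2 := pow_le_pow_left₀ (by positivity) h1 4
    have e : (2 * P) ^ 4 = 16 * P ^ 4 := by ring
    linarith only [h2, e]
  have hF1 : (1 + (u₀ + 2 / γ)) ^ 4 * Tb ≤ 16 * P ^ 4 * (tT * (P ^ 7 * Rc ^ 3) * ME ^ 2) :=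
    mul_le_mul h14 hTle hT0 (by positivity)
  have hF2 : 16 * Qb ≤ 16 * ((16 / γ ^ 2 + sS) * P ^ 8 * ME ^ 2) := by linarith only [hQle]
  have hP811 : P ^ 8 ≤ P ^ 11 * Rc ^ 3 := by
    have := mul_le_mul (hPpow (show 8 ≤ 11 by norm_num)) hR03 (by norm_num) (by positivity)
    rw [mul_one] at this; exact this
  have hF3 : 16 * ((16 / γ ^ 2 + sS) * P ^ 8 * ME ^ 2) ≤ 16 * ((16 / γ ^ 2 + sS) * (P ^ 11 * Rc ^ 3) * ME ^ 2) := by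
    have := mul_le_mul_of_nonneg_right (mul_le_mul_of_nonneg_left hP811 (show 0 ≤ 16 / γ ^ 2 + sS by positivity)) hME2
    linarith only [this]
  rw [hKc]
  have e : (16 * tT + 16 * (16 / γ ^ 2 + sS)) * (1 + u₀) ^ 11 * Rc ^ 3 * ME ^ 2
      = 16 * P ^ 4 * (tT * (P ^ 7 * Rc ^ 3) * ME ^ 2) + 16 * ((16 / γ ^ 2 + sS) * (P ^ 11 * Rc ^ 3) * ME ^ 2) := by
    rw [hPdef]; ring
  rw [e]; linarith only [hF1, hF2, hF3]

end Summit.NavierStokesRegularity.NavierStokesRegularity.Theorems.DefectColumnGate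

end
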